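import Literature.MathematicalPhysics.QuantumFieldTheory.Balaban1983to89.T3TiltDescent
import Summits.QuantumFields.YangMills.Theorems.AlphaInputsT3ACv3EMLTwoFieldIterUniformAllL
import HarnessLib

/-!
# (AVG-SYM-J) — THE REAL-SIDE JUNCTION: `descendTo` IS the `(K−n)`-fold (0.4) symmetric average, read bond by bond
(OWNER RULING g25-№3 §3(c); ym3-torus seat ym-ust-20520-w3 g2; `--supports stmt-QuantumFields-19200 --as helper`)

YM₃ on T³ is a RUNG of the ladder (R3), not the Clay problem.

WHAT IS PROVED (sorry-free, no definition; `G` any gauge group, `ℰ` any loop average — the route's `ℰp = expMeanLogSU (n := Fin 2)` is an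
instance by `rfl`; letters `T3TiltDescent.descendTo`, `Averaging.iter`, `BlockAveraging.blockAvg`, `T3LevelShift.{fieldShift, bondShift, siteShift}`):
* (J0) `descendTo_eq_fieldShift_iter` — the letter, by `rfl`: `D_{n,K} U = fieldShift h_{n,K} (M^{K−n} U)`, `M = blockAvg ℰ` at every height.
* (J1) `descendTo_apply` — bondwise: `D_{n,K} U b = (M^{K−n} U) (bondShift h_{n,K} b)` (`rfl`); (J2) `descendTo_apply_symm` — the inverse reading
  `D_{n,K} U (bondShift⁻¹ c) = (M^{K−n} U) c` for every level-`(K−n)` bond `c` of run `K`.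
* (J3) «through members» = LABELS: `val_bondShift_src`, `bondShift_dir'` — the level-`(K−n)` bond of run `K` and the level-`0` bond of run `n`
  have the SAME integer coordinates and direction (so every coordinate chart — `siteEquiv`, `siteEquivTower` — reads them identically).
* (J4) transfer schemas `forall_descendTo_iff`, `forall_descendTo_iff₂`, `forall_descendTo_iff₂'` — any bondwise (one-field, two-field,
  two-field-with-a-level-`(K−n)`-letter) statement about `M^{K−n}` on run `K` is the same statement about `D_{n,K}` on run `n`'s lattice:
  sup-norm letters of the 19936 EML engine (`EMLIterUniformAllL.*`, generic `P`, at `P := F.P K`, `s := K − n`) move across VERBATIM.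
* (J5) ★ THE 19936 EML ENGINE READ AT `descendTo` (flat background, `SU(N)`, the exp-mean-log average `expMeanLogSU` — the route's `ℰp` at `N = 2`):
  `norm_descendTo_sub_one_le_and_sub_lin_le` (first order: `‖D U(b) − 1‖ ≤ 2m`, `‖D U(b) − 1 − Q^{(K−n)}(U − 1)(bondShift b)‖ ≤ C₁·m²`,
  `m = (d+1)L^{K−n}δ`) and `norm_descendTo_sub_descendTo_le_and_sub_lin_le` (two fields: `‖D U₁(b) − D U₂(b)‖ ≤ 2m(ρ)`,
  `‖D U₁(b) − D U₂(b) − Q^{(K−n)}(U₁ − U₂)(bondShift b)‖ ≤ C₂·m(ρ)(m(ρ) + m(δ))`) — `EMLIterUniformAllL.norm_iter_sub_one_sub_iterLin_le_uniform_allL` ∕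
  `norm_iter_sub_iter_sub_iterLin_le_uniform_allL` at `P := F.P K`, `k = s := K − n` (`K − n ≤ m + K` discharged) by `exact` through (J1): the by-name
  evidence that the SYMMETRIC engine reaches the route's letter `descendTo`.  The CURVED-background lift is (AVG-SYM-44), not here.
-/

set_option autoImplicit false

noncomputable section

namespace Summit.QuantumFields.YangMills.Theorems.Prop7DescendJunction

open Literature.MathematicalPhysics.QuantumFieldTheory.Balaban1983to89
open T3ContinuumYM3Torus (T3Family)
open T3TiltDescent (descendTo)
open T3LevelShift (fieldShift bondShift siteShift coordEquiv)

variable (F : T3Family) {G : Type*} [GaugeGroup G] (ℰ : LoopAverage G) {n K : ℕ} (h : n ≤ K)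

/-! ## §1 The letter -/

/-- (J0) **`D_{n,K} = fieldShift ∘ M^{K−n}`** — the definition of `descendTo`, as a citable equation ([Balaban1987RG1] (0.11): `Ū^k = M^k(U)` is one
formula at every level; the level identification reads run `K`'s height-`(K−n)` field as run `n`'s finest field). [cite: Balaban1987RG1, (0.11) p.253] -/
theorem descendTo_eq_fieldShift_iter (U : GaugeField (F.P K) 0 G) :
    descendTo F ℰ n K h U =
      fieldShift (F.sitesPerDir_eq (m := F.m) (K := n) (j := 0) (m' := F.m) (K' := K) (j' := K - n) (by omega))
        (Averaging.iter (fun i => BlockAveraging.blockAvg (P := F.P K) (j := i) ℰ) (K - n) U) :=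
  rfl

/-- (J1) **bondwise**: `(D_{n,K} U)(b) = (M^{K−n} U)(bondShift b)` for every bond `b` of run `n`'s finest lattice. [cite: Balaban1987RG1, (0.11) p.253] -/
theorem descendTo_apply (U : GaugeField (F.P K) 0 G) (b : PBond (F.P n) 0) :
    descendTo F ℰ n K h U b =
      Averaging.iter (fun i => BlockAveraging.blockAvg (P := F.P K) (j := i) ℰ) (K - n) U
        (bondShift (F.sitesPerDir_eq (m := F.m) (K := n) (j := 0) (m' := F.m) (K' := K) (j' := K - n) (by omega)) b) :=
  rfl

/-- (J2) **inverse reading**: `(D_{n,K} U)(bondShift⁻¹ c) = (M^{K−n} U)(c)` for every height-`(K−n)` bond `c` of run `K`. [cite: Balaban1987RG1, (0.11) p.253] -/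
theorem descendTo_apply_symm (U : GaugeField (F.P K) 0 G) (c : PBond (F.P K) (K - n)) :
    descendTo F ℰ n K h U
        ((bondShift (F.sitesPerDir_eq (m := F.m) (K := n) (j := 0) (m' := F.m) (K' := K) (j' := K - n) (by omega))).symm c) =
      Averaging.iter (fun i => BlockAveraging.blockAvg (P := F.P K) (j := i) ℰ) (K - n) U c := by
  rw [descendTo_apply, Equiv.apply_symm_apply]

/-! ## §2 «Through members»: the reindexed bond has the same labels and direction -/

/-- (J3) the level identification of bonds keeps every integer coordinate of the source. [cite: Balaban1987RG1, (0.1) p.251] -/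
theorem val_bondShift_src {m K₁ j m' K' j' : ℕ} (hh : (F.PP m K₁).sitesPerDir j = (F.PP m' K').sitesPerDir j')
    (b : PBond (F.PP m K₁) j) (ν : Fin 3) : (((bondShift hh b).src) ν).val = ((b.src) ν).val := by
  rw [T3LevelShift.bondShift_src, T3LevelShift.siteShift_apply, T3LevelShift.coordEquiv_val]

/-- (J3) … and of the target. [cite: Balaban1987RG1, (0.1) p.251] -/
theorem val_bondShift_tgt {m K₁ j m' K' j' : ℕ} (hh : (F.PP m K₁).sitesPerDir j = (F.PP m' K').sitesPerDir j')
    (b : PBond (F.PP m K₁) j) (ν : Fin 3) : (((bondShift hh b).tgt) ν).val = ((b.tgt) ν).val := by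
  rw [T3LevelShift.bondShift_tgt, T3LevelShift.siteShift_apply, T3LevelShift.coordEquiv_val]

/-- (J3) … and of the inverse identification. [cite: Balaban1987RG1, (0.1) p.251] -/
theorem val_bondShift_symm_src {m K₁ j m' K' j' : ℕ} (hh : (F.PP m K₁).sitesPerDir j = (F.PP m' K').sitesPerDir j')
    (c : PBond (F.PP m' K') j') (ν : Fin 3) : ((((bondShift hh).symm c).src) ν).val = ((c.src) ν).val := by
  conv_rhs => rw [← (bondShift hh).apply_symm_apply c]
  rw [val_bondShift_src]

/-- (J3) the direction of the inversely identified bond. [cite: Balaban1987RG1, (0.1) p.251] -/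
theorem bondShift_symm_dir {m K₁ j m' K' j' : ℕ} (hh : (F.PP m K₁).sitesPerDir j = (F.PP m' K').sitesPerDir j')
    (c : PBond (F.PP m' K') j') : ((bondShift hh).symm c).dir = c.dir := by
  conv_rhs => rw [← (bondShift hh).apply_symm_apply c]
  rw [T3LevelShift.bondShift_dir]

/-- (J3) at the junction: the bond of run `K` at height `K − n` over which `D_{n,K}U(b)` is the symmetric average has the coordinates and the direction
of `b`. [cite: Balaban1987RG1, (0.11) p.253] -/
theorem descendTo_bond_labels (b : PBond (F.P n) 0) (ν : Fin 3) :
    ((bondShift (F.sitesPerDir_eq (m := F.m) (K := n) (j := 0) (m' := F.m) (K' := K) (j' := K - n) (by omega)) b).src ν).val = (b.src ν).val ∧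
      (bondShift (F.sitesPerDir_eq (m := F.m) (K := n) (j := 0) (m' := F.m) (K' := K) (j' := K - n) (by omega)) b).dir = b.dir :=
  ⟨val_bondShift_src F _ b ν, T3LevelShift.bondShift_dir _ b⟩

/-! ## §3 Transfer schemas: bondwise statements move across the junction verbatim -/

/-- (J4) one field: a bondwise property of `D_{n,K}U` on run `n`'s lattice ⟺ the same property of `M^{K−n}U` on run `K`'s height-`(K−n)` bonds.
[cite: Balaban1987RG1, (0.11) p.253] -/
theorem forall_descendTo_iff (U : GaugeField (F.P K) 0 G) (p : G → Prop) :
    (∀ b : PBond (F.P n) 0, p (descendTo F ℰ n K h U b)) ↔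
      ∀ c : PBond (F.P K) (K - n), p (Averaging.iter (fun i => BlockAveraging.blockAvg (P := F.P K) (j := i) ℰ) (K - n) U c) := by
  constructor
  · intro hb c
    rw [← descendTo_apply_symm F ℰ h U c]
    exact hb _
  · intro hc b
    rw [descendTo_apply]
    exact hc _

/-- (J4) two fields (sup-distance letters `‖D U₁(b) − D U₂(b)‖ ≤ r`). [cite: Balaban1987RG1, (0.11) p.253] -/
theorem forall_descendTo_iff₂ (U₁ U₂ : GaugeField (F.P K) 0 G) (r : G → G → Prop) :
    (∀ b : PBond (F.P n) 0, r (descendTo F ℰ n K h U₁ b) (descendTo F ℰ n K h U₂ b)) ↔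
      ∀ c : PBond (F.P K) (K - n),
        r (Averaging.iter (fun i => BlockAveraging.blockAvg (P := F.P K) (j := i) ℰ) (K - n) U₁ c)
          (Averaging.iter (fun i => BlockAveraging.blockAvg (P := F.P K) (j := i) ℰ) (K - n) U₂ c) := by
  constructor
  · intro hb c
    rw [← descendTo_apply_symm F ℰ h U₁ c, ← descendTo_apply_symm F ℰ h U₂ c]
    exact hb _
  · intro hc b
    rw [descendTo_apply, descendTo_apply]
    exact hc _

/-- (J4) two fields and a height-`(K−n)` letter (e.g. the linearised average `Q^{(K−n)}(U₁ − U₂)(c)` of the EML engine): the letter is read at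
`bondShift b`. [cite: Balaban1987RG1, (0.11) p.253] -/
theorem forall_descendTo_iff₂' (U₁ U₂ : GaugeField (F.P K) 0 G) (r : PBond (F.P K) (K - n) → G → G → Prop) :
    (∀ b : PBond (F.P n) 0,
        r (bondShift (F.sitesPerDir_eq (m := F.m) (K := n) (j := 0) (m' := F.m) (K' := K) (j' := K - n) (by omega)) b)
          (descendTo F ℰ n K h U₁ b) (descendTo F ℰ n K h U₂ b)) ↔
      ∀ c : PBond (F.P K) (K - n),
        r c (Averaging.iter (fun i => BlockAveraging.blockAvg (P := F.P K) (j := i) ℰ) (K - n) U₁ c)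
          (Averaging.iter (fun i => BlockAveraging.blockAvg (P := F.P K) (j := i) ℰ) (K - n) U₂ c) := by
  constructor
  · intro hb c
    have hb' := hb ((bondShift (F.sitesPerDir_eq (m := F.m) (K := n) (j := 0) (m' := F.m) (K' := K) (j' := K - n) (by omega))).symm c)
    rwa [Equiv.apply_symm_apply, descendTo_apply_symm, descendTo_apply_symm] at hb'
  · intro hc b
    rw [descendTo_apply, descendTo_apply]
    exact hc _

/-! ## §4 (J5) The 19936 EML engine read at `descendTo` (flat background) -/

section EML

open scoped Matrix.Norms.L2Operator
open BlockAveraging (blockAvg)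
open ExpMeanLog (expMeanLogSU deltaSU)
open BlockAveragingEMLLinearised (linAvg)

variable {N : Type*} [Fintype N] [DecidableEq N] [Nonempty N]

/-- (J5, first order) **`D_{n,K}` IS C^{1,1} AT THE FLAT FIELD, IN THE ROUTE'S LETTER**: for an `SU(N)` field `U` of run `K` with `‖U_b − 1‖ ≤ δ` and any
family `Q` of composites of the linearised average, under the three displayed smallness rows at `k = K − n`
(`m := (d+1)·L^{K−n}·δ`, `C₁ = (d+1)·18^d(2+(d+1)18^d)·324ℓ²/(L(L−1))`, `ℓ = (d+2)L`, `d = 3`): for every bond `b` of run `n`'s finest lattice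
`‖D_{n,K}U(b) − 1‖ ≤ 2m` and `‖D_{n,K}U(b) − 1 − Q^{(K−n)}(U − 1)(bondShift b)‖ ≤ C₁·m²` — `EMLIterUniformAllL.norm_iter_sub_one_sub_iterLin_le_uniform_allL`
at `P := F.P K`, `s = k = K − n`, through (J1). [cite: Balaban1985Averaging, Prop. 4 (134)–(135) p.38; Balaban1987RG1, (0.4)+(0.11) p.253] -/
theorem norm_descendTo_sub_one_le_and_sub_lin_le
    (Q : (i : ℕ) → (PBond (F.P K) 0 → Matrix N N ℂ) → PBond (F.P K) i → Matrix N N ℂ)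
    (hQ0 : ∀ Y, Q 0 Y = Y)
    (hQs : ∀ (i : ℕ) (Y : PBond (F.P K) 0 → Matrix N N ℂ) (c : PBond (F.P K) (i + 1)), Q (i + 1) Y c = linAvg (Q i Y) c)
    (U : GaugeField (F.P K) 0 (Matrix.specialUnitaryGroup N ℂ)) {δ : ℝ} (hδ : 0 ≤ δ)
    (hU : ∀ b, ‖((U b : Matrix.specialUnitaryGroup N ℂ) : Matrix N N ℂ) - 1‖ ≤ δ)
    (hm : ((((F.P K).d : ℝ) + 1) * ((18 : ℝ) ^ (F.P K).d * (2 + (((F.P K).d : ℝ) + 1) * (18 : ℝ) ^ (F.P K).d)) *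
        (324 * ((((F.P K).d + 2) * (F.P K).L : ℕ) : ℝ) ^ 2) / (((F.P K).L : ℝ) * (((F.P K).L : ℝ) - 1))) *
        ((((F.P K).d : ℝ) + 1) * ((F.P K).L : ℝ) ^ (K - n) * δ) ≤ 1)
    (h32 : 32 * ((((F.P K).d + 2) * (F.P K).L : ℕ) : ℝ) * ((((F.P K).d : ℝ) + 1) * ((F.P K).L : ℝ) ^ (K - n) * δ) ≤ 1)
    (hN : 4 * ((((F.P K).d + 2) * (F.P K).L : ℕ) : ℝ) * ((((F.P K).d : ℝ) + 1) * ((F.P K).L : ℝ) ^ (K - n) * δ) < deltaSU N) :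
    ∀ b : PBond (F.P n) 0,
      ‖((descendTo F (expMeanLogSU (n := N)) n K h U b : Matrix.specialUnitaryGroup N ℂ) : Matrix N N ℂ) - 1‖ ≤
          2 * ((((F.P K).d : ℝ) + 1) * ((F.P K).L : ℝ) ^ (K - n) * δ) ∧
      ‖((descendTo F (expMeanLogSU (n := N)) n K h U b : Matrix.specialUnitaryGroup N ℂ) : Matrix N N ℂ) - 1 -
          Q (K - n) (fun b' => ((U b' : Matrix.specialUnitaryGroup N ℂ) : Matrix N N ℂ) - 1)
            (bondShift (F.sitesPerDir_eq (m := F.m) (K := n) (j := 0) (m' := F.m) (K' := K) (j' := K - n) (by omega)) b)‖ ≤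
        ((((F.P K).d : ℝ) + 1) * ((18 : ℝ) ^ (F.P K).d * (2 + (((F.P K).d : ℝ) + 1) * (18 : ℝ) ^ (F.P K).d)) *
          (324 * ((((F.P K).d + 2) * (F.P K).L : ℕ) : ℝ) ^ 2) / (((F.P K).L : ℝ) * (((F.P K).L : ℝ) - 1))) *
          ((((F.P K).d : ℝ) + 1) * ((F.P K).L : ℝ) ^ (K - n) * δ) ^ 2 := by
  have hk : K - n ≤ (F.P K).m + (F.P K).K := by
    have := F.hm
    show K - n ≤ F.m + K
    omega
  intro b
  rw [descendTo_apply]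
  exact EMLIterUniformAllL.norm_iter_sub_one_sub_iterLin_le_uniform_allL Q hQ0 hQs U hδ hU (K - n) hk hm h32 hN (K - n) le_rfl _

/-- (J5, two fields) **`D_{n,K}` IS C^{1,1} NEAR THE FLAT FIELD — THE DERIVATIVE ROW, IN THE ROUTE'S LETTER**: for `SU(N)` fields `U₁, U₂` of run `K` with
`‖U₂,b − 1‖ ≤ δ`, `‖U₁,b − U₂,b‖ ≤ ρ`, any family `Q` of composites of the linearised average, under the four displayed smallness rows at `k = K − n`
(`m(x) := (d+1)·L^{K−n}·x`, `C₂ = (d+1)·18^d(2+(d+1)18^d)·5200ℓ²/(L(L−1))`): for every bond `b` of run `n`'s finest lattice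
`‖D U₁(b) − D U₂(b)‖ ≤ 2m(ρ)` and `‖D U₁(b) − D U₂(b) − Q^{(K−n)}(U₁ − U₂)(bondShift b)‖ ≤ C₂·m(ρ)(m(ρ) + m(δ))` —
`EMLIterUniformAllL.norm_iter_sub_iter_sub_iterLin_le_uniform_allL` at `P := F.P K`, `s = k = K − n`, through (J1).
[cite: Balaban1985Averaging, Prop. 5 (156)–(157) p.42, Prop. 4 (134)–(135) p.38; Balaban1987RG1, (0.4)+(0.11) p.253] -/
theorem norm_descendTo_sub_descendTo_le_and_sub_lin_le
    (Q : (i : ℕ) → (PBond (F.P K) 0 → Matrix N N ℂ) → PBond (F.P K) i → Matrix N N ℂ)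
    (hQ0 : ∀ Y, Q 0 Y = Y)
    (hQs : ∀ (i : ℕ) (Y : PBond (F.P K) 0 → Matrix N N ℂ) (c : PBond (F.P K) (i + 1)), Q (i + 1) Y c = linAvg (Q i Y) c)
    (U₁ U₂ : GaugeField (F.P K) 0 (Matrix.specialUnitaryGroup N ℂ)) {δ ρ : ℝ} (hδ : 0 ≤ δ) (hρ0 : 0 ≤ ρ)
    (hU₂ : ∀ b, ‖((U₂ b : Matrix.specialUnitaryGroup N ℂ) : Matrix N N ℂ) - 1‖ ≤ δ)
    (hρ : ∀ b, ‖((U₁ b : Matrix.specialUnitaryGroup N ℂ) : Matrix N N ℂ) - ((U₂ b : Matrix.specialUnitaryGroup N ℂ) : Matrix N N ℂ)‖ ≤ ρ)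
    (hmδ : ((((F.P K).d : ℝ) + 1) * ((18 : ℝ) ^ (F.P K).d * (2 + (((F.P K).d : ℝ) + 1) * (18 : ℝ) ^ (F.P K).d)) *
        (324 * ((((F.P K).d + 2) * (F.P K).L : ℕ) : ℝ) ^ 2) / (((F.P K).L : ℝ) * (((F.P K).L : ℝ) - 1))) *
        ((((F.P K).d : ℝ) + 1) * ((F.P K).L : ℝ) ^ (K - n) * δ) ≤ 1)
    (h200 : 200 * ((((F.P K).d + 2) * (F.P K).L : ℕ) : ℝ) *
        ((((F.P K).d : ℝ) + 1) * ((F.P K).L : ℝ) ^ (K - n) * ρ + (((F.P K).d : ℝ) + 1) * ((F.P K).L : ℝ) ^ (K - n) * δ) ≤ 1)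
    (hm : ((((F.P K).d : ℝ) + 1) * ((18 : ℝ) ^ (F.P K).d * (2 + (((F.P K).d : ℝ) + 1) * (18 : ℝ) ^ (F.P K).d)) *
        (5200 * ((((F.P K).d + 2) * (F.P K).L : ℕ) : ℝ) ^ 2) / (((F.P K).L : ℝ) * (((F.P K).L : ℝ) - 1))) *
        ((((F.P K).d : ℝ) + 1) * ((F.P K).L : ℝ) ^ (K - n) * ρ + (((F.P K).d : ℝ) + 1) * ((F.P K).L : ℝ) ^ (K - n) * δ) ≤ 1)
    (hN : 4 * ((((F.P K).d + 2) * (F.P K).L : ℕ) : ℝ) *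
        ((((F.P K).d : ℝ) + 1) * ((F.P K).L : ℝ) ^ (K - n) * ρ + (((F.P K).d : ℝ) + 1) * ((F.P K).L : ℝ) ^ (K - n) * δ) < deltaSU N) :
    ∀ b : PBond (F.P n) 0,
      ‖((descendTo F (expMeanLogSU (n := N)) n K h U₁ b : Matrix.specialUnitaryGroup N ℂ) : Matrix N N ℂ) -
          ((descendTo F (expMeanLogSU (n := N)) n K h U₂ b : Matrix.specialUnitaryGroup N ℂ) : Matrix N N ℂ)‖ ≤
          2 * ((((F.P K).d : ℝ) + 1) * ((F.P K).L : ℝ) ^ (K - n) * ρ) ∧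
      ‖((descendTo F (expMeanLogSU (n := N)) n K h U₁ b : Matrix.specialUnitaryGroup N ℂ) : Matrix N N ℂ) -
          ((descendTo F (expMeanLogSU (n := N)) n K h U₂ b : Matrix.specialUnitaryGroup N ℂ) : Matrix N N ℂ) -
          Q (K - n) (fun b' => ((U₁ b' : Matrix.specialUnitaryGroup N ℂ) : Matrix N N ℂ) - ((U₂ b' : Matrix.specialUnitaryGroup N ℂ) : Matrix N N ℂ))
            (bondShift (F.sitesPerDir_eq (m := F.m) (K := n) (j := 0) (m' := F.m) (K' := K) (j' := K - n) (by omega)) b)‖ ≤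
        ((((F.P K).d : ℝ) + 1) * ((18 : ℝ) ^ (F.P K).d * (2 + (((F.P K).d : ℝ) + 1) * (18 : ℝ) ^ (F.P K).d)) *
          (5200 * ((((F.P K).d + 2) * (F.P K).L : ℕ) : ℝ) ^ 2) / (((F.P K).L : ℝ) * (((F.P K).L : ℝ) - 1))) *
          (((((F.P K).d : ℝ) + 1) * ((F.P K).L : ℝ) ^ (K - n) * ρ) *
            (((((F.P K).d : ℝ) + 1) * ((F.P K).L : ℝ) ^ (K - n) * ρ) + ((((F.P K).d : ℝ) + 1) * ((F.P K).L : ℝ) ^ (K - n) * δ))) := by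
  have hk : K - n ≤ (F.P K).m + (F.P K).K := by
    have := F.hm
    show K - n ≤ F.m + K
    omega
  intro b
  rw [descendTo_apply, descendTo_apply]
  exact EMLIterUniformAllL.norm_iter_sub_iter_sub_iterLin_le_uniform_allL Q hQ0 hQs U₁ U₂ hδ hρ0 hU₂ hρ (K - n) hk hmδ h200 hm hN
    (K - n) le_rfl _

end EML

end Summit.QuantumFields.YangMills.Theorems.Prop7DescendJunction

end
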